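import Summits.HodgeConjecture.HodgeConjecture.Theorems.F0P2oLineWeilDictionaryFrameTransport -- ★ p836339 (FX) ED. 1: `dictionary_transport` (+ its import cone: `FinLocalSplittings`, `gram`, the CM vocabulary)
import HarnessLib

/-!
# Crux `H413` — N3 ROAD (a), row (CC): CONGRUENCE CHANGE — the (E4) dictionary of `X_v(μ, ε, χ_f)` does not depend on the form congruence `T` (same `η`)

F0∕P2, cell `hodgecm-mathlib`, crux item `stmt-HodgeConjecture-24833`; A-p01 (g19) on the K1∕N3 lead B-p18 (g29)'s dealing 2026-08-31T22:45:27Z (2) ∕ 23:11:56Z.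
PROOF lane (theorems only; no `def`, no instance, no notation, no `sorry`); `--supports stmt-HodgeConjecture-24833 --as helper`.  HONEST LABEL: HC_CM is proved
only modulo the printed citations until rung 0 closes; this file proves NO letter — it is plumbing for the (a)-side assembler of N3 #96.

THE POINT.  Liu's local theta type is read on the quasi-split avatar `U(Φ₃)(L⁺_v)` through a CHART `ch_T := localLineInl ∘ localPiEquiv⁻¹ ∘ cmDatumLocalCongr T` along a form
congruence `ᵗT̄ · diag(dV)_v · T = a · Φ₃`, and the N3 letter quantifies over ALL such `T` while the (E5) assembler works at ONE block-adapted `T₀` ((BF), A-p16 (g24)).  Two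
congruences of the same `diag dV` differ by a `Φ₃`-SIMILITUDE `g = T₀⁻¹T`, and in odd rank `g = λ·k` with `λ` a scalar and `k ∈ U(Φ₃)(L⁺_v)` UNITARY; scalars conjugate
trivially, so `ch_T = ch_{T₀} ∘ Ad(k)` and the Weil operator `ω_v(ch_{T₀} k)` intertwines `ω_v ∘ ch_T` with `ω_v ∘ ch_{T₀}`.  By the generic ★ `dictionary_transport` of (FX) ED. 1
(line side: identity), an (E4)-shaped dictionary `(π, σ, Tr, η)` for `(dV, T₀)` yields `(π ∘ ω_v(ch_{T₀} k⁻¹), σ, Tr, η)` for `(dV, T)` — the SAME `σ`, the SAME `η`.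

* §1 (CC-1) **`dictionary_congruenceChange`** — the transport GIVEN the unitary `k` (`hk : cmDatumLocalCongr T u = cmDatumLocalCongr T₀ (k u k⁻¹)` on matrices), generic in the
  local splitting package `𝓢` of the pair (no rigidity needed: same `dV`, same package); the centre commutes with `ω_v(ch_{T₀} k⁻¹)` by ★ `localCenter_comm`.
(CC-2), the EXISTENCE of `k` from `(T₀, a₀, h₀)`, `(T, a, h)` (`λ := det(T₀⁻¹T)·a₀∕a`, `λλ̄ = a∕a₀` by ★ `det_formCongr` in rank 3), lands in a later edition ∕ from (BF).

References: [GelbartRogawski1991] §3.2 p. 457; [Rogawski1990] §1.9 p. 8 (similitudes `GU` in odd rank), §14.2 p. 232; [MoeglinVignerasWaldspurger1987] Chap. 2 II Remarque (3);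
[PlatonovRapinchuk1994] §2.3.
-/

set_option autoImplicit false
-- the mandated namespace repeats `HodgeConjecture.HodgeConjecture`, as in every `Theorems/*.lean` of this sub-problem
set_option linter.dupNamespace false

noncomputable section

open NumberField IsDedekindDomain Matrix MeasureTheory
open scoped MatrixGroups Kronecker
open Literature.NumberTheory.Automorphic Literature.NumberTheory.Automorphic.UnitaryGroup
open Literature.NumberTheory.GelbartRogawski1991 Literature.NumberTheory.GelbartRogawski1991.UnitaryDualPair
open Literature.NumberTheory.GelbartRogawski1991.UnitaryDualPair.LocalSplitting Literature.NumberTheory.GelbartRogawski1991.UnitaryDualPair.WeilCoinv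
open Literature.NumberTheory.GelbartRogawski1991.GRConstruction
open Literature.NumberTheory.Automorphic.IdeleClassGroup
open Literature.NumberTheory.Automorphic.Liu2021 Literature.NumberTheory.Automorphic.Liu2021.Def411WeilCarriers
open Literature.NumberTheory.Automorphic.Liu2021.Def411WeilCarriersDoubling
open Literature.RepresentationTheory Literature.RepresentationTheory.HeisenbergGroup Literature.RepresentationTheory.Liu2021
open Literature.NumberTheory.GaloisRepresentations Literature.RepresentationTheory.HarrisKudlaSweet1996
open Literature.NumberTheory.Rogawski1990

namespace Summit.HodgeConjecture.HodgeConjecture.Cruxes.H413.F0P2oLineWeilDictionaryCongruenceChange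

open Summit.HodgeConjecture.HodgeConjecture.Cruxes.H413.F0P2oLineWeilDictionaryFrameTransport

variable (L : Type) [Field L] [NumberField L] [IsCMField L] (v : HeightOneSpectrum (𝓞 ↥(maximalRealSubfield L)))
  (dV : Fin 3 → L) (hdV : ∀ i, IsCMField.complexConj L (dV i) = dV i) (hdV0 : ∀ i, dV i ≠ 0)
  {n' : ℕ} (e₁ : Fin 3 × Fin 1 ≃ Fin n') (ε : (↥(maximalRealSubfield L))ˣ)
  (𝓢 : FinLocalSplittings (↥(maximalRealSubfield L)) L (IsCMField.complexConj L) n' (complexConj_imagUnit L) (imagUnit_ne_zero L)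
    (imagUnit_mul_self L) (UnitaryDualPair.gram (↥(maximalRealSubfield L)) e₁ (realDiagonal L dV hdV) (TW (↥(maximalRealSubfield L)) ε))
    (isSymm_gram (↥(maximalRealSubfield L)) e₁ (realDiagonal_isSymm L dV hdV) (isSymm_TW (↥(maximalRealSubfield L)) ε))
    (J := Matrix.reindex e₁ e₁ (Matrix.diagonal dV ⊗ₖ JW (↥(maximalRealSubfield L)) L ε))
    (reindex_kronecker_eq_gram_map (↥(maximalRealSubfield L)) L e₁ (realDiagonal_map L dV hdV).symm (JW_eq (↥(maximalRealSubfield L)) L ε)))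
  (T₀ : GL (Fin 3) (LocalRing L v)) {a₀ : LocalRing L v} (ha₀ : IsUnit a₀)
  (h₀ : formCongr (conjLocal L (IsCMField.complexConj L) v) T₀ ((Matrix.diagonal dV).map (algebraMap L (LocalRing L v))) =
    a₀ • (Matrix.of fun i j : Fin 3 => if i.val + j.val + 1 = 3 then (1 : L) else 0).map (algebraMap L (LocalRing L v)))
  (T : GL (Fin 3) (LocalRing L v)) {a : LocalRing L v} (ha : IsUnit a)
  (h : formCongr (conjLocal L (IsCMField.complexConj L) v) T ((Matrix.diagonal dV).map (algebraMap L (LocalRing L v))) =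
    a • (Matrix.of fun i j : Fin 3 => if i.val + j.val + 1 = 3 then (1 : L) else 0).map (algebraMap L (LocalRing L v)))
  (k : Gqs L v)
  (hk : ∀ u : Gqs L v, ((cmDatumLocalCongr L v T ha h u).val : GL (Fin 3) (LocalRing L v)) = (cmDatumLocalCongr L v T₀ ha₀ h₀ (k * u * k⁻¹)).val)

/-! ## §1 (CC-1) the transport given the unitary `k` -/

include hk in
/-- **the two charts differ by `Ad(k)`**: `ch_T u = ch_{T₀} (k u k⁻¹)` in `U(diag dV ⊗ (ε))(L⁺_v)` (from `hk`, through `localPiEquiv⁻¹` and `localLineInl`). [cite: PlatonovRapinchuk1994, §2.3] -/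
theorem chart_eq_chart_conj (u : Gqs L v) :
    localLineInl L (IsCMField.complexConj L) 3 e₁ (Matrix.diagonal dV) (JW (↥(maximalRealSubfield L)) L ε) v
        ((localPiEquiv L (IsCMField.complexConj L) 3 (Matrix.diagonal dV) v).symm (cmDatumLocalCongr L v T ha h u)) =
      localLineInl L (IsCMField.complexConj L) 3 e₁ (Matrix.diagonal dV) (JW (↥(maximalRealSubfield L)) L ε) v
        ((localPiEquiv L (IsCMField.complexConj L) 3 (Matrix.diagonal dV) v).symm (cmDatumLocalCongr L v T₀ ha₀ h₀ (k * u * k⁻¹))) := by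
  have hu : cmDatumLocalCongr L v T ha h u = cmDatumLocalCongr L v T₀ ha₀ h₀ (k * u * k⁻¹) := Subtype.ext (hk u)
  rw [hu]

include hk in
set_option synthInstance.maxHeartbeats 400000 in
set_option maxHeartbeats 4000000 in
/-- **(CC-1) THE (E4) DICTIONARY TRANSPORTS ALONG A CHANGE OF FORM CONGRUENCE — SAME `σ`, SAME `η`.**  For two congruences `(T₀, a₀, h₀)`, `(T, a, h)` of the SAME `diag dV`
and a UNITARY `k ∈ U(Φ₃)(L⁺_v)` with `T·u·T⁻¹ = T₀·(k u k⁻¹)·T₀⁻¹` (`hk`; in odd rank such a `k` always exists: `T₀⁻¹T = λ·k`), every (E4)-shaped dictionary `(π, σ, Tr, η)`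
(F0P2-p01 (g8)'s `exists_dictionary_upToChar` four-clause ∃, VERBATIM tokens) for the chart `ch_{T₀}` yields one for the chart `ch_T`: `(π ∘ ω_v(ch_{T₀} k⁻¹), σ, Tr, η)` —
★ `dictionary_transport` at the Weil operator `Φ := ω_v(ch_{T₀} k⁻¹)` (inverse `ω_v(ch_{T₀} k)`), which intertwines `ω_v ∘ ch_T = ω_v ∘ ch_{T₀} ∘ Ad(k)` with `ω_v ∘ ch_{T₀}`
and commutes with the centre (★ `localCenter_comm`); line side the identity.  Generic in the package `𝓢` (no rigidity: same `dV`, same `𝓢`).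
[cite: GelbartRogawski1991, §3.2 (3.2.1)–(3.2.2) p. 457] [cite: Rogawski1990, §14.2 p. 232] [cite: MoeglinVignerasWaldspurger1987, Chap. 2 II Remarque (3)] -/
theorem dictionary_congruenceChange (N : Subgroup (Gqs L v)) {n₀ : ℕ} (e₀ : Fin 1 × Fin 1 ≃ Fin n₀)
    (μ : Literature.NumberTheory.Automorphic.IdeleClassGroup L →ₜ* Circle) (hμ : IsConjugateSymplectic L μ)
    {M : Type} [AddCommGroup M] [Module ℂ M] (η : localPi L (IsCMField.complexConj L) 1 (JW (↥(maximalRealSubfield L)) L ε) v →* ℂˣ)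
    (hdict : ∃ (π : SchwartzBruhat (Fin n' → v.adicCompletion (↥(maximalRealSubfield L))) →ₗ[ℂ] M)
        (σ : Representation ℂ (localPi L (IsCMField.complexConj L) 1 (JW (↥(maximalRealSubfield L)) L ε) v) M)
        (Tr : M ≃ₗ[ℂ] SchwartzBruhat (Fin n₀ → v.adicCompletion (↥(maximalRealSubfield L)))),
      Function.Surjective π ∧
      LinearMap.ker π = Representation.Coinvariants.ker
        ((((MpPsi.toRep (localSchrodinger (↥(maximalRealSubfield L)) n' (UnitaryDualPair.gram (↥(maximalRealSubfield L)) e₁ (realDiagonal L dV hdV) (TW (↥(maximalRealSubfield L)) ε)) v)).comp (𝓢.s v)).comp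
          ((localLineInl L (IsCMField.complexConj L) 3 e₁ (Matrix.diagonal dV) (JW (↥(maximalRealSubfield L)) L ε) v).comp
            ((localPiEquiv L (IsCMField.complexConj L) 3 (Matrix.diagonal dV) v).symm.toMonoidHom.comp (cmDatumLocalCongr L v T₀ ha₀ h₀).toMonoidHom))).comp N.subtype) ∧
      (∀ (u : localPi L (IsCMField.complexConj L) 1 (JW (↥(maximalRealSubfield L)) L ε) v) (f : SchwartzBruhat (Fin n' → v.adicCompletion (↥(maximalRealSubfield L)))),
        π (MpPsi.toRep (localSchrodinger (↥(maximalRealSubfield L)) n' (UnitaryDualPair.gram (↥(maximalRealSubfield L)) e₁ (realDiagonal L dV hdV) (TW (↥(maximalRealSubfield L)) ε)) v)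
          (𝓢.s v (localCenter L (IsCMField.complexConj L) n' (Matrix.reindex e₁ e₁ (Matrix.diagonal dV ⊗ₖ JW (↥(maximalRealSubfield L)) L ε)) (JW (↥(maximalRealSubfield L)) L ε) (JW_apply_ne_zero (↥(maximalRealSubfield L)) L ε) v u)) f) = σ u (π f)) ∧
      ∀ (u : localPi L (IsCMField.complexConj L) 1 (JW (↥(maximalRealSubfield L)) L ε) v) (m : M),
        lineWeilCM L e₀ (kernelLineCM dV) (complexConj_kernelLineCM dV hdV) (kernelLineCM_ne_zero dV hdV0) μ hμ ε v u (Tr m) = ((η u : ℂˣ) : ℂ) • Tr (σ u m)) :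
    ∃ (π' : SchwartzBruhat (Fin n' → v.adicCompletion (↥(maximalRealSubfield L))) →ₗ[ℂ] M)
        (σ : Representation ℂ (localPi L (IsCMField.complexConj L) 1 (JW (↥(maximalRealSubfield L)) L ε) v) M)
        (Tr' : M ≃ₗ[ℂ] SchwartzBruhat (Fin n₀ → v.adicCompletion (↥(maximalRealSubfield L)))),
      Function.Surjective π' ∧
      LinearMap.ker π' = Representation.Coinvariants.ker
        ((((MpPsi.toRep (localSchrodinger (↥(maximalRealSubfield L)) n' (UnitaryDualPair.gram (↥(maximalRealSubfield L)) e₁ (realDiagonal L dV hdV) (TW (↥(maximalRealSubfield L)) ε)) v)).comp (𝓢.s v)).comp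
          ((localLineInl L (IsCMField.complexConj L) 3 e₁ (Matrix.diagonal dV) (JW (↥(maximalRealSubfield L)) L ε) v).comp
            ((localPiEquiv L (IsCMField.complexConj L) 3 (Matrix.diagonal dV) v).symm.toMonoidHom.comp (cmDatumLocalCongr L v T ha h).toMonoidHom))).comp N.subtype) ∧
      (∀ (u : localPi L (IsCMField.complexConj L) 1 (JW (↥(maximalRealSubfield L)) L ε) v) (f : SchwartzBruhat (Fin n' → v.adicCompletion (↥(maximalRealSubfield L)))),
        π' (MpPsi.toRep (localSchrodinger (↥(maximalRealSubfield L)) n' (UnitaryDualPair.gram (↥(maximalRealSubfield L)) e₁ (realDiagonal L dV hdV) (TW (↥(maximalRealSubfield L)) ε)) v)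
          (𝓢.s v (localCenter L (IsCMField.complexConj L) n' (Matrix.reindex e₁ e₁ (Matrix.diagonal dV ⊗ₖ JW (↥(maximalRealSubfield L)) L ε)) (JW (↥(maximalRealSubfield L)) L ε) (JW_apply_ne_zero (↥(maximalRealSubfield L)) L ε) v u)) f) = σ u (π' f)) ∧
      ∀ (u : localPi L (IsCMField.complexConj L) 1 (JW (↥(maximalRealSubfield L)) L ε) v) (m : M),
        lineWeilCM L e₀ (kernelLineCM dV) (complexConj_kernelLineCM dV hdV) (kernelLineCM_ne_zero dV hdV0) μ hμ ε v u (Tr' m) = ((η u : ℂˣ) : ℂ) • Tr' (σ u m) := by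
  -- the Weil representation of the pair, read on `U(Φ₃)` through the chart `ch_{T₀}`
  let ω₀ : Representation ℂ (Gqs L v) (SchwartzBruhat (Fin n' → v.adicCompletion (↥(maximalRealSubfield L)))) :=
    ((MpPsi.toRep (localSchrodinger (↥(maximalRealSubfield L)) n' (UnitaryDualPair.gram (↥(maximalRealSubfield L)) e₁ (realDiagonal L dV hdV) (TW (↥(maximalRealSubfield L)) ε)) v)).comp (𝓢.s v)).comp
      ((localLineInl L (IsCMField.complexConj L) 3 e₁ (Matrix.diagonal dV) (JW (↥(maximalRealSubfield L)) L ε) v).comp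
        ((localPiEquiv L (IsCMField.complexConj L) 3 (Matrix.diagonal dV) v).symm.toMonoidHom.comp (cmDatumLocalCongr L v T₀ ha₀ h₀).toMonoidHom))
  have hωmul : ∀ x y : Gqs L v, ω₀ (x * y) = ω₀ x * ω₀ y := fun x y => map_mul ω₀ x y
  -- the intertwiner `Φ := ω₀ k⁻¹`, inverse `ω₀ k`
  let Φ : SchwartzBruhat (Fin n' → v.adicCompletion (↥(maximalRealSubfield L))) ≃ₗ[ℂ] SchwartzBruhat (Fin n' → v.adicCompletion (↥(maximalRealSubfield L))) :=
    LinearEquiv.ofLinear (ω₀ k⁻¹) (ω₀ k) (by rw [← Module.End.mul_eq_comp, ← hωmul, inv_mul_cancel, map_one]; rfl)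
      (by rw [← Module.End.mul_eq_comp, ← hωmul, mul_inv_cancel, map_one]; rfl)
  refine dictionary_transport _ _
    (((MpPsi.toRep (localSchrodinger (↥(maximalRealSubfield L)) n' (UnitaryDualPair.gram (↥(maximalRealSubfield L)) e₁ (realDiagonal L dV hdV) (TW (↥(maximalRealSubfield L)) ε)) v)).comp (𝓢.s v)).comp
      (localCenter L (IsCMField.complexConj L) n' (Matrix.reindex e₁ e₁ (Matrix.diagonal dV ⊗ₖ JW (↥(maximalRealSubfield L)) L ε)) (JW (↥(maximalRealSubfield L)) L ε)
        (JW_apply_ne_zero (↥(maximalRealSubfield L)) L ε) v))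
    (((MpPsi.toRep (localSchrodinger (↥(maximalRealSubfield L)) n' (UnitaryDualPair.gram (↥(maximalRealSubfield L)) e₁ (realDiagonal L dV hdV) (TW (↥(maximalRealSubfield L)) ε)) v)).comp (𝓢.s v)).comp
      (localCenter L (IsCMField.complexConj L) n' (Matrix.reindex e₁ e₁ (Matrix.diagonal dV ⊗ₖ JW (↥(maximalRealSubfield L)) L ε)) (JW (↥(maximalRealSubfield L)) L ε)
        (JW_apply_ne_zero (↥(maximalRealSubfield L)) L ε) v))
    Φ ?_ ?_ _ _ (LinearEquiv.refl ℂ _) (fun _ _ => rfl) η hdict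
  · -- `Φ ∘ ω(ch_T n) = ω(ch_{T₀} n) ∘ Φ` for `n ∈ N`: `ch_T n = ch_{T₀}(k n k⁻¹)` and `map_mul`
    intro g f
    have hTg : ((MpPsi.toRep (localSchrodinger (↥(maximalRealSubfield L)) n' (UnitaryDualPair.gram (↥(maximalRealSubfield L)) e₁ (realDiagonal L dV hdV) (TW (↥(maximalRealSubfield L)) ε)) v)).comp (𝓢.s v))
        (localLineInl L (IsCMField.complexConj L) 3 e₁ (Matrix.diagonal dV) (JW (↥(maximalRealSubfield L)) L ε) v
          ((localPiEquiv L (IsCMField.complexConj L) 3 (Matrix.diagonal dV) v).symm (cmDatumLocalCongr L v T ha h (g : Gqs L v)))) =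
        ω₀ (k * (g : Gqs L v) * k⁻¹) :=
      congrArg (fun x => ((MpPsi.toRep (localSchrodinger (↥(maximalRealSubfield L)) n' (UnitaryDualPair.gram (↥(maximalRealSubfield L)) e₁ (realDiagonal L dV hdV) (TW (↥(maximalRealSubfield L)) ε)) v)).comp (𝓢.s v)) x)
        (chart_eq_chart_conj L v dV e₁ ε T₀ ha₀ h₀ T ha h k hk (g : Gqs L v))
    change ω₀ k⁻¹ (((MpPsi.toRep (localSchrodinger (↥(maximalRealSubfield L)) n' (UnitaryDualPair.gram (↥(maximalRealSubfield L)) e₁ (realDiagonal L dV hdV) (TW (↥(maximalRealSubfield L)) ε)) v)).comp (𝓢.s v))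
        (localLineInl L (IsCMField.complexConj L) 3 e₁ (Matrix.diagonal dV) (JW (↥(maximalRealSubfield L)) L ε) v
          ((localPiEquiv L (IsCMField.complexConj L) 3 (Matrix.diagonal dV) v).symm (cmDatumLocalCongr L v T ha h (g : Gqs L v)))) f) =
      ω₀ (g : Gqs L v) (ω₀ k⁻¹ f)
    rw [hTg, ← Module.End.mul_apply, ← hωmul, ← Module.End.mul_apply, ← hωmul]
    congr 2
    group
  · -- the centre commutes with `ω₀ k⁻¹` (★ `localCenter_comm`)
    intro u f
    simp only [MonoidHom.comp_apply]
    change ω₀ k⁻¹ (((MpPsi.toRep (localSchrodinger (↥(maximalRealSubfield L)) n' (UnitaryDualPair.gram (↥(maximalRealSubfield L)) e₁ (realDiagonal L dV hdV) (TW (↥(maximalRealSubfield L)) ε)) v)).comp (𝓢.s v))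
        (localCenter L (IsCMField.complexConj L) n' (Matrix.reindex e₁ e₁ (Matrix.diagonal dV ⊗ₖ JW (↥(maximalRealSubfield L)) L ε)) (JW (↥(maximalRealSubfield L)) L ε)
          (JW_apply_ne_zero (↥(maximalRealSubfield L)) L ε) v u) f) = _
    change ((MpPsi.toRep (localSchrodinger (↥(maximalRealSubfield L)) n' (UnitaryDualPair.gram (↥(maximalRealSubfield L)) e₁ (realDiagonal L dV hdV) (TW (↥(maximalRealSubfield L)) ε)) v)).comp (𝓢.s v))
        (localLineInl L (IsCMField.complexConj L) 3 e₁ (Matrix.diagonal dV) (JW (↥(maximalRealSubfield L)) L ε) v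
          ((localPiEquiv L (IsCMField.complexConj L) 3 (Matrix.diagonal dV) v).symm (cmDatumLocalCongr L v T₀ ha₀ h₀ k⁻¹))) _ = _
    rw [← Module.End.mul_apply, ← map_mul, localCenter_comm, map_mul, Module.End.mul_apply]
    rfl

end Summit.HodgeConjecture.HodgeConjecture.Cruxes.H413.F0P2oLineWeilDictionaryCongruenceChange

end
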